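import Summits.Ventures.PercRepro.S1EightFiveFourFour
import Summits.Ventures.PercRepro.S1OneSeparableNineFive

/-!
# PercRepro — EVERY `1`-SEPARABLE `(8, 5)` CORE SATISFIES THE `(8, 4)` BODY (p2, gen 28; SUBCLAIM-S1 §6.10
(xvii)(l))

The `(8, 5)` twin of `S1OneSeparableNineFive`. A finite coloop-free matroid of rank `8` on `13` points with all
pairs of rank `2` and a proper separator `A`: both parts are coloop-free hence dependent and of rank `≥ 2`, the
nullities add to `5` — nullity `1` is a circuit of `M` (`rls_eight_four_of_circuit_separator`, every circuit
summand), otherwise the corank-`2` part has rank `k ∈ {2, …, 6}` and the consumers `S1EightFive{RankTwoParts,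
FiveThree, ThreeFive, FourFour}` apply through the bridge `eq_disjointSum_restrict_of_separator`.
Nothing is claimed about any cell.

* `rls_eight_four_of_corank_two_separator_{two, three, four, five, six}` — the five shapes in RLS form;
* **`rls_eight_four_of_separator`** — the capstone at `(8, 5)`.
Axioms: standard.
-/

open scoped Matroid

namespace PercRepro

namespace S1

open Set

variable {α : Type}

/-- The complement of a separator of rank `k` in a matroid of rank `k + l` has rank `l` (as a restriction). -/
theorem restrict_compl_eRank_of_separator (M : Matroid α) [M.Finite] {A : Set α}
    (hsep : M.eRk A + M.eRk (M.E \ A) = M.eRank) {k l : ℕ} (hk : M.eRk A = (k : ℕ∞))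
    (hM : M.eRank = ((k + l : ℕ) : ℕ∞)) : (M ↾ (M.E \ A)).eRank = (l : ℕ∞) := by
  rw [Matroid.eRank_restrict]
  have h := hsep
  rw [hk, hM] at h
  have hfin : M.eRk (M.E \ A) ≠ ⊤ :=
    ((M.eRk_le_encard _).trans_lt (M.ground_finite.subset sdiff_subset).encard_lt_top).ne
  obtain ⟨r, hr⟩ := ENat.ne_top_iff_exists.mp hfin
  rw [← hr] at h ⊢
  have h' : k + r = k + l := by exact_mod_cast h
  have hrl : r = l := by omega
  rw [hrl]

/-- Pairs keep rank `2` in a restriction. -/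
theorem restrict_pairs_of_pairs (M : Matroid α) (hpairs : ∀ e ∈ M.E, ∀ f ∈ M.E, e ≠ f → M.eRk {e, f} = 2)
    {R : Set α} (hR : R ⊆ M.E) : ∀ e ∈ (M ↾ R).E, ∀ f ∈ (M ↾ R).E, e ≠ f → (M ↾ R).eRk {e, f} = 2 := by
  intro e he f hf hef
  rw [Matroid.restrict_ground_eq] at he hf
  rw [M.restrict_eRk_eq (show ({e, f} : Set α) ⊆ R from by
    intro x hx
    rcases hx with rfl | rfl
    · exact he
    · exact hf)]
  exact hpairs e (hR he) f (hR hf) hef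

section Shapes

variable (M : Matroid α) [M.Finite] {A : Set α} (hA : A ⊆ M.E) (hsep : M.eRk A + M.eRk (M.E \ A) = M.eRank)
  (hpairs : ∀ e ∈ M.E, ∀ f ∈ M.E, e ≠ f → M.eRk {e, f} = 2) (hM : M.eRank = ((8 : ℕ) : ℕ∞))
  (hE : M.E.ncard = 13)

include hA hsep hpairs hM hE

/-- `(8, 4)` with a `4`-point line as a separator — the `(6, 2)` shape. -/
theorem rls_eight_four_of_corank_two_separator_two (hA4 : A.ncard = 4) (hrA : M.eRk A = ((2 : ℕ) : ℕ∞)) :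
    ThmN.RLS M 8 4 := by
  have hB : M.E \ A ⊆ M.E := sdiff_subset
  have hsep' : M.eRk (M.E \ A) + M.eRk (M.E \ (M.E \ A)) = M.eRank := by
    rw [sdiff_sdiff_cancel_left hA, add_comm]; exact hsep
  have heq := eq_disjointSum_restrict_of_separator M hB hsep'
  haveI hBfin : (M ↾ (M.E \ A)).Finite := Matroid.restrict_finite (M.ground_finite.subset hB)
  haveI hAfin : (M ↾ A).Finite := Matroid.restrict_finite (M.ground_finite.subset hA)
  have hrB := restrict_compl_eRank_of_separator M hsep (k := 2) (l := 6) hrA hM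
  have hBE : (M ↾ (M.E \ A)).E.ncard = 9 := by
    rw [Matroid.restrict_ground_eq, ncard_sdiff' hA M.ground_finite, hE, hA4]
  have hrA' : (M ↾ A).eRank = ((2 : ℕ) : ℕ∞) := by rw [Matroid.eRank_restrict]; exact hrA
  have hAE' : (M ↾ A).E.ncard = 4 := by rw [Matroid.restrict_ground_eq]; exact hA4
  unfold ThmN.RLS
  rw [heq]
  have hAA : M.E \ (M.E \ A) = A := sdiff_sdiff_cancel_left hA
  have key := c025_eight_four_disjointSum_six_two (M ↾ (M.E \ A)) (M ↾ A)
    (by simp only [Matroid.restrict_ground_eq]; exact disjoint_sdiff_left) hrB hBE hrA' hAE'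
    (restrict_pairs_of_pairs M hpairs hA)
  convert key using 3 <;> simp only [hAA]

/-- `(8, 4)` with a rank-`3` separator of `5` points — the `(5, 3)` shape. -/
theorem rls_eight_four_of_corank_two_separator_three (hA5 : A.ncard = 5) (hrA : M.eRk A = ((3 : ℕ) : ℕ∞))
    (hcol : M.coloops = ∅) : ThmN.RLS M 8 4 := by
  have hB : M.E \ A ⊆ M.E := sdiff_subset
  have hsep' : M.eRk (M.E \ A) + M.eRk (M.E \ (M.E \ A)) = M.eRank := by
    rw [sdiff_sdiff_cancel_left hA, add_comm]; exact hsep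
  have heq := eq_disjointSum_restrict_of_separator M hB hsep'
  haveI hBfin : (M ↾ (M.E \ A)).Finite := Matroid.restrict_finite (M.ground_finite.subset hB)
  haveI hAfin : (M ↾ A).Finite := Matroid.restrict_finite (M.ground_finite.subset hA)
  have hrB := restrict_compl_eRank_of_separator M hsep (k := 3) (l := 5) hrA hM
  have hBE : (M ↾ (M.E \ A)).E.ncard = 8 := by
    rw [Matroid.restrict_ground_eq, ncard_sdiff' hA M.ground_finite, hE, hA5]
  have hrA' : (M ↾ A).eRank = ((3 : ℕ) : ℕ∞) := by rw [Matroid.eRank_restrict]; exact hrA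
  have hAE' : (M ↾ A).E.ncard = 5 := by rw [Matroid.restrict_ground_eq]; exact hA5
  have hcolB : (M ↾ (M.E \ A)).coloops = ∅ := restrict_coloops_eq_empty_of_separator M hB hsep' hcol
  have hcolA : (M ↾ A).coloops = ∅ := restrict_coloops_eq_empty_of_separator M hA hsep hcol
  unfold ThmN.RLS
  rw [heq]
  have hAA : M.E \ (M.E \ A) = A := sdiff_sdiff_cancel_left hA
  have key := c025_eight_four_disjointSum_five_three (M ↾ (M.E \ A)) (M ↾ A)
    (by simp only [Matroid.restrict_ground_eq]; exact disjoint_sdiff_left) hrB hBE hcolB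
    (restrict_pairs_of_pairs M hpairs hB) hrA' hAE' hcolA (restrict_pairs_of_pairs M hpairs hA)
  convert key using 3 <;> simp only [hAA]

/-- `(8, 4)` with a rank-`4` separator of `6` points — the `(4, 4)` shape. -/
theorem rls_eight_four_of_corank_two_separator_four (hA6 : A.ncard = 6) (hrA : M.eRk A = ((4 : ℕ) : ℕ∞))
    (hcol : M.coloops = ∅) : ThmN.RLS M 8 4 := by
  have hB : M.E \ A ⊆ M.E := sdiff_subset
  have hsep' : M.eRk (M.E \ A) + M.eRk (M.E \ (M.E \ A)) = M.eRank := by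
    rw [sdiff_sdiff_cancel_left hA, add_comm]; exact hsep
  have heq := eq_disjointSum_restrict_of_separator M hB hsep'
  haveI hBfin : (M ↾ (M.E \ A)).Finite := Matroid.restrict_finite (M.ground_finite.subset hB)
  haveI hAfin : (M ↾ A).Finite := Matroid.restrict_finite (M.ground_finite.subset hA)
  have hrB := restrict_compl_eRank_of_separator M hsep (k := 4) (l := 4) hrA hM
  have hBE : (M ↾ (M.E \ A)).E.ncard = 7 := by
    rw [Matroid.restrict_ground_eq, ncard_sdiff' hA M.ground_finite, hE, hA6]
  have hrA' : (M ↾ A).eRank = ((4 : ℕ) : ℕ∞) := by rw [Matroid.eRank_restrict]; exact hrA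
  have hAE' : (M ↾ A).E.ncard = 6 := by rw [Matroid.restrict_ground_eq]; exact hA6
  have hcolB : (M ↾ (M.E \ A)).coloops = ∅ := restrict_coloops_eq_empty_of_separator M hB hsep' hcol
  have hcolA : (M ↾ A).coloops = ∅ := restrict_coloops_eq_empty_of_separator M hA hsep hcol
  unfold ThmN.RLS
  rw [heq]
  have hAA : M.E \ (M.E \ A) = A := sdiff_sdiff_cancel_left hA
  have key := c025_eight_four_disjointSum_four_four (M ↾ (M.E \ A)) (M ↾ A)
    (by simp only [Matroid.restrict_ground_eq]; exact disjoint_sdiff_left) hrB hBE hcolB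
    (restrict_pairs_of_pairs M hpairs hB) hrA' hAE' hcolA (restrict_pairs_of_pairs M hpairs hA)
  convert key using 3 <;> simp only [hAA]

/-- `(8, 4)` with a rank-`5` separator of `7` points — the `(3, 5)` shape. -/
theorem rls_eight_four_of_corank_two_separator_five (hA7 : A.ncard = 7) (hrA : M.eRk A = ((5 : ℕ) : ℕ∞))
    (hcol : M.coloops = ∅) : ThmN.RLS M 8 4 := by
  have hB : M.E \ A ⊆ M.E := sdiff_subset
  have hsep' : M.eRk (M.E \ A) + M.eRk (M.E \ (M.E \ A)) = M.eRank := by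
    rw [sdiff_sdiff_cancel_left hA, add_comm]; exact hsep
  have heq := eq_disjointSum_restrict_of_separator M hB hsep'
  haveI hBfin : (M ↾ (M.E \ A)).Finite := Matroid.restrict_finite (M.ground_finite.subset hB)
  haveI hAfin : (M ↾ A).Finite := Matroid.restrict_finite (M.ground_finite.subset hA)
  have hrB := restrict_compl_eRank_of_separator M hsep (k := 5) (l := 3) hrA hM
  have hBE : (M ↾ (M.E \ A)).E.ncard = 6 := by
    rw [Matroid.restrict_ground_eq, ncard_sdiff' hA M.ground_finite, hE, hA7]
  have hrA' : (M ↾ A).eRank = ((5 : ℕ) : ℕ∞) := by rw [Matroid.eRank_restrict]; exact hrA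
  have hAE' : (M ↾ A).E.ncard = 7 := by rw [Matroid.restrict_ground_eq]; exact hA7
  have hcolB : (M ↾ (M.E \ A)).coloops = ∅ := restrict_coloops_eq_empty_of_separator M hB hsep' hcol
  have hcolA : (M ↾ A).coloops = ∅ := restrict_coloops_eq_empty_of_separator M hA hsep hcol
  unfold ThmN.RLS
  rw [heq]
  have hAA : M.E \ (M.E \ A) = A := sdiff_sdiff_cancel_left hA
  have key := c025_eight_four_disjointSum_three_five (M ↾ (M.E \ A)) (M ↾ A)
    (by simp only [Matroid.restrict_ground_eq]; exact disjoint_sdiff_left) hrB hBE hcolB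
    (restrict_pairs_of_pairs M hpairs hB) hrA' hAE' hcolA (restrict_pairs_of_pairs M hpairs hA)
  convert key using 3 <;> simp only [hAA]

/-- `(8, 4)` with a rank-`6` separator of `8` points — the `(2, 6)` shape (the complement is `U_{2,5}`). -/
theorem rls_eight_four_of_corank_two_separator_six (hA8 : A.ncard = 8) (hrA : M.eRk A = ((6 : ℕ) : ℕ∞)) :
    ThmN.RLS M 8 4 := by
  have hB : M.E \ A ⊆ M.E := sdiff_subset
  have hsep' : M.eRk (M.E \ A) + M.eRk (M.E \ (M.E \ A)) = M.eRank := by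
    rw [sdiff_sdiff_cancel_left hA, add_comm]; exact hsep
  have heq := eq_disjointSum_restrict_of_separator M hB hsep'
  haveI hBfin : (M ↾ (M.E \ A)).Finite := Matroid.restrict_finite (M.ground_finite.subset hB)
  haveI hAfin : (M ↾ A).Finite := Matroid.restrict_finite (M.ground_finite.subset hA)
  have hrB := restrict_compl_eRank_of_separator M hsep (k := 6) (l := 2) hrA hM
  have hBE : (M ↾ (M.E \ A)).E.ncard = 5 := by
    rw [Matroid.restrict_ground_eq, ncard_sdiff' hA M.ground_finite, hE, hA8]
  have hrA' : (M ↾ A).eRank = ((6 : ℕ) : ℕ∞) := by rw [Matroid.eRank_restrict]; exact hrA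
  have hAE' : (M ↾ A).E.ncard = 8 := by rw [Matroid.restrict_ground_eq]; exact hA8
  unfold ThmN.RLS
  rw [heq]
  have hAA : M.E \ (M.E \ A) = A := sdiff_sdiff_cancel_left hA
  have key := c025_eight_four_disjointSum_two_six (M ↾ (M.E \ A)) (M ↾ A)
    (by simp only [Matroid.restrict_ground_eq]; exact disjoint_sdiff_left) hrB hBE
    (restrict_pairs_of_pairs M hpairs hB) hrA' hAE'
  convert key using 3 <;> simp only [hAA]

end Shapes

/-- **THE CAPSTONE AT `(8, 5)`**: a finite coloop-free matroid of rank `8` on `13` points with all pairs of rank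
`2` that has a proper separator satisfies `ThmN.RLS M 8 4`. -/
theorem rls_eight_four_of_separator (M : Matroid α) [M.Finite] {A : Set α} (hA : A ⊆ M.E) (hne : A.Nonempty)
    (hne' : (M.E \ A).Nonempty) (hsep : M.eRk A + M.eRk (M.E \ A) = M.eRank)
    (hpairs : ∀ e ∈ M.E, ∀ f ∈ M.E, e ≠ f → M.eRk {e, f} = 2) (hM : M.eRank = ((8 : ℕ) : ℕ∞))
    (hE : M.E.ncard = 13) (hcol : M.coloops = ∅) : ThmN.RLS M 8 4 := by
  have hB : M.E \ A ⊆ M.E := sdiff_subset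
  have hAA : M.E \ (M.E \ A) = A := sdiff_sdiff_cancel_left hA
  have hsep' : M.eRk (M.E \ A) + M.eRk (M.E \ (M.E \ A)) = M.eRank := by
    rw [hAA, add_comm]; exact hsep
  have hne'' : (M.E \ (M.E \ A)).Nonempty := by rw [hAA]; exact hne
  have hfinA : M.eRk A ≠ ⊤ := ((M.eRk_le_encard _).trans_lt (M.ground_finite.subset hA).encard_lt_top).ne
  have hfinB : M.eRk (M.E \ A) ≠ ⊤ :=
    ((M.eRk_le_encard _).trans_lt (M.ground_finite.subset hB).encard_lt_top).ne
  obtain ⟨k, hk⟩ := ENat.ne_top_iff_exists.mp hfinA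
  obtain ⟨l, hl⟩ := ENat.ne_top_iff_exists.mp hfinB
  have hkA : M.eRk A = (k : ℕ∞) := hk.symm
  have hlB : M.eRk (M.E \ A) = (l : ℕ∞) := hl.symm
  have hkl : k + l = 8 := by
    have h := hsep
    rw [hkA, hlB, hM] at h
    exact_mod_cast h
  have hsize : A.ncard + (M.E \ A).ncard = 13 := by
    rw [ncard_sdiff' hA M.ground_finite, hE]
    have := ncard_le_ncard hA M.ground_finite
    rw [hE] at this
    omega
  have hdepA := eRk_add_one_le_ncard_of_separator M hA hsep hcol hne hkA
  have hdepB := eRk_add_one_le_ncard_of_separator M hB hsep' hcol hne' hlB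
  have hk2 := two_le_of_separator_part M hA hpairs hne' hkA hdepA
  have hl2 := two_le_of_separator_part M hB hpairs hne'' hlB hdepB
  -- the two circuit cases
  rcases Nat.lt_or_ge A.ncard (k + 2) with hcA | hcA
  · have hA1 : A.ncard = k + 1 := by omega
    have hC := isCircuit_of_separator_of_ncard_eq M hA hsep hcol hkA hA1
    have hsepC : M.eRk (M.E \ A) + M.eRk A = M.eRank := by rw [add_comm]; exact hsep
    exact rls_eight_four_of_circuit_separator M hC hsepC (by omega) hM hcol
  rcases Nat.lt_or_ge (M.E \ A).ncard (l + 2) with hcB | hcB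
  · have hB1 : (M.E \ A).ncard = l + 1 := by omega
    have hC := isCircuit_of_separator_of_ncard_eq M hB hsep' hcol hlB hB1
    have hsepC : M.eRk (M.E \ (M.E \ A)) + M.eRk (M.E \ A) = M.eRank := by rw [add_comm]; exact hsep'
    exact rls_eight_four_of_circuit_separator M hC hsepC (by omega) hM hcol
  -- the split cases
  have hk6 : k ≤ 6 := by omega
  have hnull : A.ncard = k + 2 ∨ A.ncard = k + 3 := by omega
  interval_cases k
  · rcases hnull with h | h
    · exact rls_eight_four_of_corank_two_separator_two M hA hsep hpairs hM hE h hkA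
    · have hlB' : M.eRk (M.E \ A) = ((6 : ℕ) : ℕ∞) := by rw [hlB]; congr 1; omega
      exact rls_eight_four_of_corank_two_separator_six M hB hsep' hpairs hM hE (by omega) hlB'
  · rcases hnull with h | h
    · exact rls_eight_four_of_corank_two_separator_three M hA hsep hpairs hM hE h hkA hcol
    · have hlB' : M.eRk (M.E \ A) = ((5 : ℕ) : ℕ∞) := by rw [hlB]; congr 1; omega
      exact rls_eight_four_of_corank_two_separator_five M hB hsep' hpairs hM hE (by omega) hlB' hcol
  · rcases hnull with h | h
    · exact rls_eight_four_of_corank_two_separator_four M hA hsep hpairs hM hE h hkA hcol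
    · have hlB' : M.eRk (M.E \ A) = ((4 : ℕ) : ℕ∞) := by rw [hlB]; congr 1; omega
      exact rls_eight_four_of_corank_two_separator_four M hB hsep' hpairs hM hE (by omega) hlB' hcol
  · rcases hnull with h | h
    · exact rls_eight_four_of_corank_two_separator_five M hA hsep hpairs hM hE h hkA hcol
    · have hlB' : M.eRk (M.E \ A) = ((3 : ℕ) : ℕ∞) := by rw [hlB]; congr 1; omega
      exact rls_eight_four_of_corank_two_separator_three M hB hsep' hpairs hM hE (by omega) hlB' hcol
  · rcases hnull with h | h
    · exact rls_eight_four_of_corank_two_separator_six M hA hsep hpairs hM hE h hkA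
    · have hlB' : M.eRk (M.E \ A) = ((2 : ℕ) : ℕ∞) := by rw [hlB]; congr 1; omega
      exact rls_eight_four_of_corank_two_separator_two M hB hsep' hpairs hM hE (by omega) hlB'

end S1

end PercRepro
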